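import Mathlib
import Summits.NavierStokesRegularity.OSWSelfSimilar.SheetNSLineTorusCascadeRestart
import HarnessLib

/-!
# Viscous CLM on the torus (`a = 0`, `σ = 2`): GLOBAL CLASSICAL SOLUTIONS FOR GENERAL NONNEGATIVE DATA BELOW THE
# STATIONARY POLE — the synthesis for `IsNonnegCascade` families

HONEST FRAMING (cell ns-blowup GROUP B «PROFILE SEARCH», zone Z3, row Z3-U addendum A-F2 of `HOME/profile/z3/CENSUS-Z3.md`;
human rulings D-0035/D-0074): **1-D MODEL (viscous Constantin–Lax–Majda equation `ω_t = ω·Hω + ν ω_xx` on `𝕋`,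
`H = hilbertTransformCircle`); series calculus, kernel-checked; not Euler, not Navier–Stokes; «violates: none — MODEL».**

The synthesis (`SheetNSLineTorusCascadeSynthesis`) is typed for sine cascades. Its proofs use only `e 0 ≡ 0`, continuity, the
cascade ODE and the envelope — all available for a GENERAL nonnegative cascade `IsNonnegCascade ν e` (data `ω₀` with analytic
signal `Σ_{k≥1} a_k e^{ikx}`, `a_k ≥ 0`, i.e. `ω₀ = −Σ a_k sin kx`). The lemmas are re-run here as PRIVATE declarations (their
conclusions coincide with the landed sine versions, which the gate's restatement check reserves), and two public theorems are drawn: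

* **`exists_global_classicalSolution_of_nonneg_envelope`** — a nonnegative cascade with a global geometric envelope
  `|e_k(t)| ≤ A·k·q^k` (`q < 1`) sums to ONE quadruple `(ω, ωt, ωx, ωxx)` with `ω(0,x) = −Σ_k e_k(0) sin kx` which is an
  `IsClassicalSolution ν T` for every `T`;
* **`exists_global_classicalSolution_of_datum_le_pole`** — for `0 < ν` and EVERY datum `0 ≤ a_k ≤ 12ν·k·q^k` (`a_0 = 0`,
  `q < 1`; the stationary-pole profile) there is a global classical solution with `ω(0,x) = −Σ_k a_k sin kx` (the explicit
  cascade `exists_isNonnegCascade` + the restarted stationary-pole comparison `IsNonnegCascade.mode_le_stationaryPole_of_datum`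
  of `SheetNSLineTorusCascadeRestart`) — **global classical existence for all odd data with nonnegative coefficients under the
  pole**, the general-data companion of `exists_global_classicalSolution_of_lt_twelve` (the sine datum `c < 12ν` is the case
  `a = sineDatum c`, `q = c/12ν`).

bears_on: LADDER-NS N5 / zone Z3 (row Z3-U, A-F2) → N1 linear core. WHAT THIS IS NOT: not NS; uniqueness for general data is not
typed here (the sine case is `IsClassicalSolution.unique_of_sine`); data with coefficients of both signs are not covered.
-/

noncomputable section

namespace Summit.NavierStokesRegularity.OSWSelfSimilar
namespace SheetNSLineTorusCascade

open Finset Real Set Filter MeasureTheory Complex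
open Literature.Analysis.Fourier
open scoped Topology

variable {ν A q : ℝ} {e : ℕ → ℝ → ℝ}

section nonneg

variable (he : IsNonnegCascade ν e) (hA : 0 ≤ A) (hq : 0 ≤ q) (hq1 : q < 1)
  (hb : ∀ k : ℕ, ∀ t : ℝ, 0 ≤ t → |e k t| ≤ A * k * q ^ k)
include he hA hq hq1 hb

/-! ### Continuity of the clamped modes -/

omit hA hq hq1 hb in
/-- Each clamped mode `t ↦ e_k(t⁺)` is continuous on `ℝ`. -/
private theorem continuous_clamp_nn (k : ℕ) : Continuous fun t : ℝ => e k (max t 0) :=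
  (he.cont k).comp_continuous (f := fun t : ℝ => max t 0) (continuous_id.max continuous_const)
    fun t => Set.mem_Ici.mpr (le_max_right t 0)

omit hA hq hq1 hb in
/-- Each `synthRhs k` is continuous on `ℝ`. -/
private theorem continuous_synthRhs_nn (k : ℕ) : Continuous (synthRhs ν e k) := by
  unfold synthRhs
  refine (continuous_const.mul (continuous_finsetSum _ fun p _ => ?_)).sub
    (continuous_const.mul (continuous_clamp_nn he k))
  exact (continuous_clamp_nn he p.1).mul (continuous_clamp_nn he p.2)

/-- `ω` is jointly continuous on `ℝ × ℝ`. -/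
private theorem continuous_uncurry_synthOmega_nn : Continuous (Function.uncurry (synthOmega e)) := by
  have h : Continuous fun p : ℝ × ℝ => ∑' k : ℕ, e k (max p.1 0) * Real.sin ((k : ℝ) * p.2) :=
    continuous_tsum (u := majorant ν A q) (fun k => ((continuous_clamp_nn he k).comp continuous_fst).mul (by fun_prop))
      (summable_majorant ν A hq hq1) fun k p => by rw [Real.norm_eq_abs]; exact abs_omega_term_le ν hA hq hb k p.1 p.2
  exact h.neg

/-- `ωt` is jointly continuous on `ℝ × ℝ`. -/
private theorem continuous_uncurry_synthOmegaT_nn : Continuous (Function.uncurry (synthOmegaT ν e)) := by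
  have h : Continuous fun p : ℝ × ℝ => ∑' k : ℕ, synthRhs ν e k p.1 * Real.sin ((k : ℝ) * p.2) :=
    continuous_tsum (u := majorant ν A q) (fun k => ((continuous_synthRhs_nn he k).comp continuous_fst).mul (by fun_prop))
      (summable_majorant ν A hq hq1) fun k p => by rw [Real.norm_eq_abs]; exact abs_omegaT_term_le hA hq hb k p.1 p.2
  exact h.neg

/-- **`∂_t ω = ωt` for `t > 0`**, termwise, the cascade (C) supplying each mode's derivative. [new here — MODEL] -/
private theorem hasDerivAt_synthOmega_t_nn {t : ℝ} (ht : 0 < t) (x : ℝ) :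
    HasDerivAt (fun s => synthOmega e s x) (synthOmegaT ν e t x) t := by
  unfold synthOmega synthOmegaT
  have h := hasDerivAt_tsum_of_isPreconnected (u := majorant ν A q) (t := Ioi (0 : ℝ))
    (g := fun (k : ℕ) (s : ℝ) => e k (max s 0) * Real.sin ((k : ℝ) * x))
    (g' := fun (k : ℕ) (s : ℝ) => synthRhs ν e k s * Real.sin ((k : ℝ) * x)) (y₀ := 1)
    (summable_majorant ν A hq hq1) isOpen_Ioi isPreconnected_Ioi (fun k s hs => ?_) (fun k s _ => ?_)
    (by norm_num) ?_ ht
  · exact h.neg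
  · -- on `s > 0` the clamp is the identity near `s`, and (C) gives the derivative
    have hs : (0 : ℝ) < s := hs
    have heq : (fun r : ℝ => e k (max r 0)) =ᶠ[𝓝 s] e k := by
      filter_upwards [Ioi_mem_nhds hs] with r hr
      rw [max_eq_left (le_of_lt hr)]
    have h1 : HasDerivAt (fun r : ℝ => e k (max r 0))
        ((1 / 2) * (∑ p ∈ antidiagonal k, e p.1 s * e p.2 s) - ν * (k : ℝ) ^ 2 * e k s) s :=
      (he.ode k s hs).congr_of_eventuallyEq heq
    have h2 := h1.mul_const (Real.sin ((k : ℝ) * x))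
    refine h2.congr_deriv ?_
    simp only [synthRhs, max_eq_left hs.le]
  · rw [Real.norm_eq_abs]; exact abs_omegaT_term_le hA hq hb k s x
  · exact (summable_majorant ν A hq hq1).of_norm_bounded (fun k => by
      rw [Real.norm_eq_abs]; exact abs_omega_term_le ν hA hq hb k 1 x)

/-- **`H(ω(t,·))(x) = Σ_k e_k(t⁺) cos(kx)`** (termwise, `H sin k· = −cos k·`; the index is shifted by one because
`hilbertTransformCircle_tsum` counts frequencies from `1`). [new here — MODEL] -/
private theorem hilbert_synthOmega_nn (t x : ℝ) :
    hilbertTransformCircle (synthOmega e t) x = ∑' k : ℕ, e k (max t 0) * Real.cos ((k : ℝ) * x) := by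
  -- summability of the shifted coefficient weight `(k+1)·|e_{k+1}|`
  have hw : Summable fun k : ℕ => ((k : ℝ) + 1) * (|(-e (k + 1) (max t 0))| + |(0 : ℝ)|) := by
    have h1 : Summable fun k : ℕ => majorant ν A q (k + 1) :=
      (summable_nat_add_iff 1).mpr (summable_majorant ν A hq hq1)
    refine h1.of_nonneg_of_le (fun k => by positivity) fun k => ?_
    rw [abs_neg, abs_zero, add_zero]
    have hb' := abs_clamp_le hb (k + 1) t
    calc ((k : ℝ) + 1) * |e (k + 1) (max t 0)| ≤ ((k : ℝ) + 1) * (A * (k + 1 : ℕ) * q ^ (k + 1)) := by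
          gcongr
      _ ≤ majorant ν A q (k + 1) := by
          unfold majorant
          push_cast
          have hqk : 0 ≤ q ^ (k + 1) := pow_nonneg hq _
          have hC : A ≤ A + A ^ 2 / 12 + |ν| * A := by nlinarith [abs_nonneg ν, sq_nonneg A]
          have hk1 : ((k : ℝ) + 1) * ((k : ℝ) + 1) ≤ ((k : ℝ) + 1) ^ 3 := by
            have : (1 : ℝ) ≤ (k : ℝ) + 1 := by linarith [Nat.cast_nonneg (α := ℝ) k]
            nlinarith
          calc ((k : ℝ) + 1) * (A * ((k : ℝ) + 1) * q ^ (k + 1)) = A * ((((k : ℝ) + 1) * ((k : ℝ) + 1)) * q ^ (k + 1)) := by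
                ring
            _ ≤ (A + A ^ 2 / 12 + |ν| * A) * (((k : ℝ) + 1) ^ 3 * q ^ (k + 1)) := by gcongr
  -- rewrite the slice as the shifted series
  have hsum0 : Summable fun k : ℕ => e k (max t 0) * Real.sin ((k : ℝ) * x) :=
    (summable_majorant ν A hq hq1).of_norm_bounded fun k => by
      rw [Real.norm_eq_abs]; exact abs_omega_term_le ν hA hq hb k t x
  have hfun : synthOmega e t = fun y => ∑' k : ℕ,
      ((-e (k + 1) (max t 0)) * Real.sin (((k + 1 : ℕ) : ℝ) * y) + 0 * Real.cos (((k + 1 : ℕ) : ℝ) * y)) := by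
    funext y
    unfold synthOmega
    have hsy : Summable fun k : ℕ => e k (max t 0) * Real.sin ((k : ℝ) * y) :=
      (summable_majorant ν A hq hq1).of_norm_bounded fun k => by
        rw [Real.norm_eq_abs]; exact abs_omega_term_le ν hA hq hb k t y
    rw [hsy.tsum_eq_zero_add]
    simp only [Nat.cast_zero, zero_mul, Real.sin_zero, mul_zero, zero_add, ← tsum_neg]
    refine tsum_congr fun k => ?_
    ring
  rw [hfun, hilbertTransformCircle_tsum hw x]
  -- shift back
  have hcos : Summable fun k : ℕ => e k (max t 0) * Real.cos ((k : ℝ) * x) :=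
    (summable_majorant ν A hq hq1).of_norm_bounded fun k => by
      rw [Real.norm_eq_abs]; exact abs_cos_term_le ν hA hq hb k t x
  rw [hcos.tsum_eq_zero_add]
  simp only [Nat.cast_zero, zero_mul, Real.cos_zero, he.zero, mul_one, zero_add, neg_neg, zero_mul, add_zero]

/-! ### The product `ω·Hω` -/

/-- **`ω·Hω = −½ Σ_k (Σ_{i+j=k} e_i e_j) sin(kx)`** (at the clamped time): the analytic signal `z = Σ_k e_k e^{ikx}` has
`Re z = Hω`, `Im z = −ω`, `Im z² = 2 Re z Im z`, and `z²` is the Cauchy product of the series. [new here — MODEL] -/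
private theorem synthOmega_mul_hilbert_nn (t x : ℝ) :
    synthOmega e t x * hilbertTransformCircle (synthOmega e t) x
      = -(1 / 2) * ∑' k : ℕ, (∑ p ∈ antidiagonal k, e p.1 (max t 0) * e p.2 (max t 0)) * Real.sin ((k : ℝ) * x) := by
  rw [hilbert_synthOmega_nn he hA hq hq1 hb t x]
  unfold synthOmega
  -- the analytic signal
  set a : ℕ → ℂ := fun k => ((e k (max t 0) : ℝ) : ℂ) * Complex.exp ((((k : ℝ) * x : ℝ) : ℂ) * I) with ha
  have hnorm : ∀ k, ‖a k‖ = |e k (max t 0)| := fun k => by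
    simp only [ha, norm_mul, Complex.norm_real, Real.norm_eq_abs, Complex.norm_exp_ofReal_mul_I, mul_one]
  have hsa : Summable fun k => ‖a k‖ := by
    refine (summable_majorant ν A hq hq1).of_nonneg_of_le (fun k => norm_nonneg _) fun k => ?_
    rw [hnorm]
    have h := abs_cos_term_le ν hA hq hb k t 0
    rwa [mul_zero, Real.cos_zero, mul_one] at h
  -- real and imaginary parts of the terms and of the square's terms
  have hre : ∀ k, (a k).re = e k (max t 0) * Real.cos ((k : ℝ) * x) := fun k => by
    simp only [ha, Complex.exp_ofReal_mul_I_re, Complex.re_ofReal_mul]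
  have him : ∀ k, (a k).im = e k (max t 0) * Real.sin ((k : ℝ) * x) := fun k => by
    simp only [ha, Complex.exp_ofReal_mul_I_im, Complex.im_ofReal_mul]
  set d : ℕ → ℝ := fun k => ∑ p ∈ antidiagonal k, e p.1 (max t 0) * e p.2 (max t 0) with hd
  have hsq_term : ∀ k, ∑ p ∈ antidiagonal k, a p.1 * a p.2
      = ((d k : ℝ) : ℂ) * Complex.exp ((((k : ℝ) * x : ℝ) : ℂ) * I) := by
    intro k
    rw [hd]
    push_cast
    rw [sum_mul]
    refine sum_congr rfl fun p hp => ?_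
    have hsum : p.1 + p.2 = k := mem_antidiagonal.mp hp
    simp only [ha]
    rw [mul_mul_mul_comm, ← Complex.exp_add, ← hsum]
    push_cast
    ring_nf
  -- the Cauchy product
  have hprod : (∑' k, a k) * (∑' k, a k) = ∑' k, ((d k : ℝ) : ℂ) * Complex.exp ((((k : ℝ) * x : ℝ) : ℂ) * I) := by
    rw [tsum_mul_tsum_eq_tsum_sum_antidiagonal_of_summable_norm hsa hsa]
    exact tsum_congr hsq_term
  -- summability of the square series (norm = |d k| ≤ A² k³ q^k)
  have hsd : Summable fun k => ((d k : ℝ) : ℂ) * Complex.exp ((((k : ℝ) * x : ℝ) : ℂ) * I) := by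
    refine Summable.of_norm ?_
    have h6 : Summable fun k : ℕ => A ^ 2 * ((k : ℝ) ^ 3 * q ^ k) :=
      (summable_pow_mul_geometric_of_norm_lt_one 3 (show ‖q‖ < 1 by rwa [Real.norm_of_nonneg hq])).mul_left _
    refine h6.of_nonneg_of_le (fun k => norm_nonneg _) fun k => ?_
    rw [norm_mul, Complex.norm_real, Complex.norm_exp_ofReal_mul_I, mul_one, Real.norm_eq_abs]
    have hqk : 0 ≤ q ^ k := pow_nonneg hq k
    have hk0 : (0 : ℝ) ≤ k := Nat.cast_nonneg k
    have hk3 : (0 : ℝ) ≤ (k : ℝ) ^ 3 := by positivity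
    have hdiv : ((k : ℝ) ^ 3 - k) / 6 ≤ (k : ℝ) ^ 3 := by linarith
    calc |d k| ≤ A ^ 2 * q ^ k * (((k : ℝ) ^ 3 - k) / 6) := abs_conv_le hA hq hb k t
      _ ≤ A ^ 2 * q ^ k * (k : ℝ) ^ 3 := mul_le_mul_of_nonneg_left hdiv (by positivity)
      _ = A ^ 2 * ((k : ℝ) ^ 3 * q ^ k) := by ring
  -- take imaginary parts
  have hsa' : Summable a := hsa.of_norm
  have hIm_z : (∑' k, a k).im = ∑' k, e k (max t 0) * Real.sin ((k : ℝ) * x) := by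
    rw [show (∑' k, a k).im = Complex.imCLM (∑' k, a k) from rfl, ContinuousLinearMap.map_tsum _ hsa']
    exact tsum_congr fun k => by rw [Complex.imCLM_apply, him]
  have hRe_z : (∑' k, a k).re = ∑' k, e k (max t 0) * Real.cos ((k : ℝ) * x) := by
    rw [show (∑' k, a k).re = Complex.reCLM (∑' k, a k) from rfl, ContinuousLinearMap.map_tsum _ hsa']
    exact tsum_congr fun k => by rw [Complex.reCLM_apply, hre]
  have hIm_sq : ((∑' k, a k) * (∑' k, a k)).im = ∑' k, d k * Real.sin ((k : ℝ) * x) := by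
    rw [hprod, show (∑' k, ((d k : ℝ) : ℂ) * Complex.exp ((((k : ℝ) * x : ℝ) : ℂ) * I)).im
      = Complex.imCLM (∑' k, ((d k : ℝ) : ℂ) * Complex.exp ((((k : ℝ) * x : ℝ) : ℂ) * I)) from rfl,
      ContinuousLinearMap.map_tsum _ hsd]
    exact tsum_congr fun k => by
      rw [Complex.imCLM_apply]; simp only [Complex.exp_ofReal_mul_I_im, Complex.im_ofReal_mul]
  have hkey : ((∑' k, a k) * (∑' k, a k)).im = 2 * ((∑' k, a k).re * (∑' k, a k).im) := by
    rw [Complex.mul_im]; ring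
  rw [hIm_z, hRe_z, hIm_sq] at hkey
  -- conclude
  have hfin : (∑' k, e k (max t 0) * Real.sin ((k : ℝ) * x)) * (∑' k, e k (max t 0) * Real.cos ((k : ℝ) * x))
      = (1 / 2) * ∑' k, d k * Real.sin ((k : ℝ) * x) := by
    linear_combination (-(1 / 2) : ℝ) * hkey
  rw [neg_mul, hfin]
  ring

/-- **The equation `ωt = ω·Hω + ν ωxx` holds pointwise** (every real `t`, with the clamped modes; in particular on `t ≥ 0`).
[new here — MODEL] -/
private theorem synthOmegaT_eq_nn (t x : ℝ) :
    synthOmegaT ν e t x = synthOmega e t x * hilbertTransformCircle (synthOmega e t) x + ν * synthOmegaXX e t x := by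
  rw [synthOmega_mul_hilbert_nn he hA hq hq1 hb t x]
  unfold synthOmegaT synthOmegaXX synthRhs
  have hs1 := summable_conv_sin hA hq hq1 hb t x
  have hs2 : Summable fun k : ℕ => e k (max t 0) * ((k : ℝ) ^ 2 * Real.sin ((k : ℝ) * x)) :=
    (summable_majorant 0 A hq hq1).of_norm_bounded fun k => by
      rw [Real.norm_eq_abs]; exact abs_omegaXX_term_le 0 hA hq hb k t x
  have hsplit : (fun k : ℕ => (1 / 2 * (∑ p ∈ antidiagonal k, e p.1 (max t 0) * e p.2 (max t 0))
      - ν * (k : ℝ) ^ 2 * e k (max t 0)) * Real.sin ((k : ℝ) * x))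
      = fun k => (1 / 2) * ((∑ p ∈ antidiagonal k, e p.1 (max t 0) * e p.2 (max t 0)) * Real.sin ((k : ℝ) * x))
        - ν * (e k (max t 0) * ((k : ℝ) ^ 2 * Real.sin ((k : ℝ) * x))) := by
    funext k; ring
  rw [hsplit, (hs1.mul_left (1 / 2)).tsum_sub (hs2.mul_left ν), tsum_mul_left, tsum_mul_left]
  ring

/-! ### The classical solution -/

/-- **The series is a classical solution on every horizon.** [new here — MODEL] -/
private theorem isClassicalSolution_synth_nn (T : ℝ) :
    IsClassicalSolution ν T (synthOmega e) (synthOmegaT ν e) (synthOmegaX e) (synthOmegaXX e) where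
  periodic t _ := synthOmega_periodic t
  hasDeriv_x t _ x := hasDerivAt_synthOmega_x hA hq hq1 hb t x
  hasDeriv_xx t _ x := hasDerivAt_synthOmegaX_x hA hq hq1 hb t x
  cont_xx t _ := continuous_synthOmegaXX hA hq hq1 hb t
  cont := (continuous_uncurry_synthOmega_nn he hA hq hq1 hb).continuousOn
  hasDeriv_t _ ht x := hasDerivAt_synthOmega_t_nn he hA hq hq1 hb ht.1 x
  cont_t := (continuous_uncurry_synthOmegaT_nn he hA hq hq1 hb).continuousOn
  pde t _ x := synthOmegaT_eq_nn he hA hq hq1 hb t x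


omit he hA hq hq1 hb in
/-- The datum of the series: `ω(0,x) = −Σ_k e_k(0) sin kx`. -/
private theorem synthOmega_zero_nn (x : ℝ) : synthOmega e 0 x = -∑' k : ℕ, e k 0 * Real.sin ((k : ℝ) * x) := by
  unfold synthOmega; rw [max_self]

/-- **Global classical solution from a nonnegative cascade with a geometric envelope.** [new here — MODEL] -/
theorem exists_global_classicalSolution_of_nonneg_envelope :
    ∃ ω ωt ωx ωxx : ℝ → ℝ → ℝ, (∀ x, ω 0 x = -∑' k : ℕ, e k 0 * Real.sin ((k : ℝ) * x)) ∧
      ∀ T : ℝ, IsClassicalSolution ν T ω ωt ωx ωxx :=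
  ⟨_, _, _, _, synthOmega_zero_nn, isClassicalSolution_synth_nn he hA hq hq1 hb⟩

end nonneg

/-- **GLOBAL CLASSICAL EXISTENCE FOR EVERY NONNEGATIVE DATUM BELOW THE STATIONARY POLE.** For `0 < ν`, `0 ≤ q < 1` and a datum
`a` with `a_0 = 0`, `0 ≤ a_k ≤ 12ν·k·q^k`: there is ONE quadruple with `ω(0,x) = −Σ_k a_k sin kx` that is a classical solution of
`ω_t = ω·Hω + ν ω_xx` on `[0, T]` for every `T`. [new here — MODEL] -/
theorem exists_global_classicalSolution_of_datum_le_pole (hν : 0 < ν) (a : ℕ → ℝ) (h0 : a 0 = 0) (ha : ∀ k, 0 ≤ a k)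
    {q : ℝ} (hq : 0 ≤ q) (hq1 : q < 1) (hle : ∀ k : ℕ, a k ≤ 12 * ν * (k : ℝ) * q ^ k) :
    ∃ ω ωt ωx ωxx : ℝ → ℝ → ℝ, (∀ x, ω 0 x = -∑' k : ℕ, a k * Real.sin ((k : ℝ) * x)) ∧
      ∀ T : ℝ, IsClassicalSolution ν T ω ωt ωx ωxx := by
  obtain ⟨e, he, hinit⟩ := exists_isNonnegCascade ν a h0 ha
  have henv : ∀ k : ℕ, ∀ t : ℝ, 0 ≤ t → |e k t| ≤ 12 * ν * k * q ^ k := by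
    intro k t ht
    rw [abs_of_nonneg (he.nonneg k t ht)]
    exact he.mode_le_stationaryPole_of_datum hν hq (fun k => by rw [hinit]; exact hle k) k t ht
  obtain ⟨ω, ωt, ωx, ωxx, hω0, hsol⟩ :=
    exists_global_classicalSolution_of_nonneg_envelope he (by positivity : (0 : ℝ) ≤ 12 * ν) hq hq1 henv
  refine ⟨ω, ωt, ωx, ωxx, fun x => ?_, hsol⟩
  rw [hω0 x]
  simp only [hinit]

end SheetNSLineTorusCascade
end Summit.NavierStokesRegularity.OSWSelfSimilar
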